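import Summits.QuantumFields.BalabanUV.Beta.FP.TorusCompositeObjects
import Summits.QuantumFields.BalabanUV.Beta.SymShiftedSpread
import Summits.QuantumFields.BalabanUV.Beta.DshAn1

/-!
# `BalabanUV.Beta.FP.TorusCompositeObjectsG` — road «FP» for binder row D1, ROUTE T: **THE COMB TOWER's KERNEL-DEPENDENT OBJECTS OVER AN ABSTRACT
# ONE-STEP ROW FAMILY, AND THEIR (0.4)-SYMMETRISED INSTANCE** — the leaf-06 item of the ROW OWNER an2 g52's RULING R-D1-g52-1 (journal l.56283, (3)(c)
# «→ leaf-06 (W-5 l.55728, option (ii)): `compRowsG Q` over an abstract step-row family, `compRows = compRowsG Qstep` by `rfl`, `QstepSym` = one def over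
# `bhKStepSh d Lc (Dsh Lc)` at root `ctr`, `compRowsSym := compRowsG QstepSym`»); [our object] bookkeeping + [folklore] `rfl`-inductions; NO landed byte moved

WHAT.  In `FP/TorusCompositeObjects` (p-landed, this lineage gen 20) exactly THREE objects read the one-step KERNEL: `Qstep` (the rooted step rows
`perF (fine Lc M) (bhKStepAt d (toSite r) Lc ℓ) ∘ ((coarsePt, inr), (·, inl))`), `compRows` (the `n`-fold product, `Qstep` on top by `rfl`) and `nestedSlice`
(`fromRows (combF · * compRows ·) (nestedSlice below)`); every other object (`towerTorus bigRatio bigRoot combF NParam towerEquiv bigP towerGen`) is comb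
GEOMETRY, kernel-free.  This file re-types the three kernel readers ONCE over an ABSTRACT step-row family
`Q : StepRows d Lc = ∀ M [NeZero ∘ M] (ℓ : ℕ) (r : Fin (d+1) → ℕ), Matrix (pbox M × Fin (d+1)) (pbox (fine Lc M) × Fin (d+1)) ℝ` by the SAME push-inside
recursion — §1 `compRowsG Lc Q` (`_zero ∕ _succ` by `rfl`, `_one` by `Matrix.mul_one`), `nestedSliceG Lc Q` (`_zero ∕ _succ` by `rfl`, `_one`) — and proves
§2 **`compRows_eq_compRowsG : compRows Lc M lev rs n = compRowsG Lc (fun M _ ℓ r => Qstep Lc M ℓ r) M lev rs n`** and **`nestedSlice_eq_nestedSliceG`**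
(structural induction, `rfl` at depth 0, the `_succ` unfoldings at depth `n+1`): THE ROOTED TOWER OF RECORD IS THE GENERIC TOWER AT `Q := Qstep Lc`, so
nothing typed against `compRows ∕ nestedSlice` (#19–#21, #41c–#42c, leaf-02's R-1 ∕ R-12, leaf-05's letters) moves.  §3 THE (0.4)-SYMMETRISED INSTANCE
(R-D1-g52-1 (3)(b): «the composite tower is re-based on an1's (0.4)-symmetrised bricks at the centred root at every level»): `QstepSym Lc M ℓ :=
perF (fine Lc M) (bhKStepSh d Lc (Dsh Lc) ℓ) ∘ ((coarsePt, inr), (·, inl))` — CHARACTER FOR CHARACTER the `hQ₁₀` binder of the (III′) torus call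
`NestedStepLawTorusTransportedRowsGradedSym.torus_t1_sym_of_average_dead` ∕ `…GradedSym` (leaf-02 g21, an2's (J-a) TABLE: `𝕄_j = bhKStepSh d Lc (Dsh Lc) j`,
an1's shifted straight spread, ROOT-FREE — the combs sit at the centred root `ctr (d+1) Lc = toSite (ctrOff (d+1) Lc)`, the kernel carries no root), hence
`QstepSym` IGNORES the root slot of `StepRows` (`abbrev QSym Lc : StepRows d Lc := fun M _ ℓ _ => QstepSym Lc M ℓ`); `abbrev compRowsSym Lc := compRowsG Lc (QSym Lc)`,
`nestedSliceSym` likewise — REDUCIBLE, so every generic theorem over `Q` serves the sym spelling by `exact` ∕ the token substitution `Q ↦ QSym Lc` —, with their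
`_zero ∕ _succ ∕ _one` unfoldings (the interface #21's sym twin and leaf-02's sym R-passes read BY NAME, as the rooted ones read `compRows_succ ∕ _one ∕
nestedSlice_succ ∕ _one`).  The comb roots `rs` stay a parameter of `compRowsSym` (signature-uniform with `compRows`; under (β1) the record takes
`rs k := ctrOff (d+1) Lc` at every level — the CONSUMER's instantiation, not fixed here).
NOT HERE (R-D1-g52-1's list, other owners): the sym one-step LAW ∕ rows for `QstepSym` (leaf-02's `stepIns₁Sym ∕ stepIns₂₂Sym` twins and R-passes; the
OWNER's generator passes #41c ∕ #41d ∕ #42a ∕ #42c and re-compositions #19–#21 over the sym instance; K-U3d's sym corrector; the row's F6d ∕ F6e); the `uTop`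
closure for the sym brick is brick-free (g31 W-6 l.56044 → R-FP-67).  [our object] bookkeeping defs (`StepRows compRowsG nestedSliceG QstepSym` + abbreviations `QSym compRowsSym
nestedSliceSym`) + [folklore] unfoldings ∕ inductions; no `def … : Prop`, nothing cited, 0 sorry, default heartbeats; nothing of the dictionary ∕ Bałaban's
asserted — WHICH presentation the record's tower takes is the ROW's ruling (R-D1-g52-1), quoted, not adjudicated here.

HONEST DEPENDENCY (page 1, mandatory): continuum YM on T⁴ ⇐ BetaPertH ∧ nine spine estimates (0/9 proved); BetaPertH ⇐ (D1) ∧ (D4) ∧ CAP+tail;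
G-an2-4 gates asym, D1 and NE2/3/4.  HONEST FRAMING (cell contract, verbatim): «discharging `BetaPertH` makes Bałaban's UV stability UNCONDITIONAL —
a real constructive-QFT result; it is NOT the continuum limit and NOT the Clay problem.»  ABSOLUTE RULE (cell charter, verbatim): «No internally-minted
statement may enter as a cited fact. Every hypothesis is either kernel-proved in this package or a verbatim quotation of a PUBLISHED theorem with page
reference. The manuscript(s) under audit are NOT citable for their own disputed steps — they are the thing under adjudication; programme-internal
(2001/route/tribunal) claims are never citable.»  0 estimates; 0∕4 row-D1 binders (hW, hR, D1Tel, D1Rep); NOT (C1), NOT (T-ID)∕(T-β) complete, NOT SDF,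
NOT D1, NOT BetaPertH, NOT continuum, NOT Clay.  D1 formalisation swarm LEAF PROVER 06 (b2b-balaban-beta-d1-formalise-leaf-06 gen 32), 2026-08-24.
No existing file touched.
-/

noncomputable section

namespace Summit.QuantumFields.BalabanUV.Beta.FP.TorusCompositeObjectsG

open Matrix
open Literature.MathematicalPhysics.QuantumFieldTheory.Balaban1983to89
open Literature.MathematicalPhysics.QuantumFieldTheory.Balaban1983to89.Beta
open B5Prop11Plancherel (fine)
open B6Lemma24Torus (pbox)
open AffineAveraging (Site toSite)
open OneStepResolventKernel (Fib)
open Summit.QuantumFields.BalabanUV.Beta.SymShiftedSpread (bhKStepSh)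
open Summit.QuantumFields.BalabanUV.Beta.DshAn1 (Dsh)
open Summit.QuantumFields.BalabanUV.Beta.FP.KernelPeriodisationFib (Idx perF)
open Summit.QuantumFields.BalabanUV.Beta.FP.TorusGaugeCovarianceCoarse (coarsePt)
open Summit.QuantumFields.BalabanUV.Beta.FP.TorusCombRows (Res)
open Summit.QuantumFields.BalabanUV.Beta.FP.TorusCompositeObjects (towerTorus Qstep combF compRows compRows_succ NParam nestedSlice nestedSlice_succ)

variable {d : ℕ}

/-! ## §1 The generic tower: composite rows and nested slice over an abstract one-step row family -/

/-- [our object — bookkeeping] **AN ABSTRACT ONE-STEP ROW FAMILY** at blocking `Lc`: for each top torus `M`, level `ℓ` and in-block root `r`, the averaging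
rows between the coarse multiplier slots of `M` and the fine field slots of `fine Lc M` — (B)'s `hQ₁₀` SHAPE as a type; `Qstep Lc` (rooted) and `QstepSym Lc`
(§3, root-free) are its two instances of record. -/
abbrev StepRows (d Lc : ℕ) : Type :=
  ∀ (M : Fin (d + 1) → ℕ) [∀ μ, NeZero (M μ)], ℕ → (Fin (d + 1) → ℕ) →
    Matrix (↥(pbox M) × Fin (d + 1)) (↥(pbox (fine Lc M)) × Fin (d + 1)) ℝ

section Generic

variable (Lc : ℕ) [NeZero Lc] (Q : StepRows d Lc)

/-- [our object — bookkeeping] **THE `n`-FOLD COMPOSITE AVERAGING OVER `Q`** — `TorusCompositeObjects.compRows`'s push-inside recursion with `Qstep Lc`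
replaced by `Q`: `1` at depth `0`; `Q M (lev 1) (rs 1) * compRowsG Q (fine Lc M) (lev ∘ succ) (rs ∘ succ) n` at depth `n+1` (indices FROM THE TOP, as there). -/
def compRowsG : (M : Fin (d + 1) → ℕ) → [∀ μ, NeZero (M μ)] → (ℕ → ℕ) → (ℕ → (Fin (d + 1) → ℕ)) → (n : ℕ) →
    Matrix (↥(pbox M) × Fin (d + 1)) (↥(pbox (towerTorus Lc M n)) × Fin (d + 1)) ℝ
  | M, _, _, _, 0 => (1 : Matrix (↥(pbox M) × Fin (d + 1)) (↥(pbox M) × Fin (d + 1)) ℝ)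
  | M, _, lev, rs, n + 1 => Q M (lev 1) (rs 1) * compRowsG (fine Lc M) (fun k => lev (k + 1)) (fun k => rs (k + 1)) n

/-- unfolding, depth `0`. -/
@[simp] theorem compRowsG_zero (M : Fin (d + 1) → ℕ) [∀ μ, NeZero (M μ)] (lev : ℕ → ℕ) (rs : ℕ → (Fin (d + 1) → ℕ)) :
    compRowsG Lc Q M lev rs 0 = (1 : Matrix (↥(pbox M) × Fin (d + 1)) (↥(pbox M) × Fin (d + 1)) ℝ) := rfl

/-- unfolding, depth `n+1` — TOP-PEEL BY `rfl`. -/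
theorem compRowsG_succ (M : Fin (d + 1) → ℕ) [∀ μ, NeZero (M μ)] (lev : ℕ → ℕ) (rs : ℕ → (Fin (d + 1) → ℕ)) (n : ℕ) :
    compRowsG Lc Q M lev rs (n + 1) = Q M (lev 1) (rs 1) * compRowsG Lc Q (fine Lc M) (fun k => lev (k + 1)) (fun k => rs (k + 1)) n := rfl

/-- the one-fold generic composite is the one-step family read at the fine level's index and root. -/
theorem compRowsG_one (M : Fin (d + 1) → ℕ) [∀ μ, NeZero (M μ)] (lev : ℕ → ℕ) (rs : ℕ → (Fin (d + 1) → ℕ)) :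
    compRowsG Lc Q M lev rs 1 = Q M (lev 1) (rs 1) :=
  Matrix.mul_one _

/-- [our object — bookkeeping] **THE NESTED COMB SLICE OVER `Q`** — `TorusCompositeObjects.nestedSlice`'s recursion with `compRows` replaced by `compRowsG Q`:
the comb rows of `M` at depth `0`; `fromRows (combF M (rs 0) * compRowsG Q M lev rs (n+1)) (nestedSliceG Q (fine Lc M) … n)` at depth `n+1`. -/
def nestedSliceG : (M : Fin (d + 1) → ℕ) → [∀ μ, NeZero (M μ)] → (lev : ℕ → ℕ) → (rs : ℕ → (Fin (d + 1) → ℕ)) → (n : ℕ) →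
    Matrix (NParam Lc M rs n) (↥(pbox (towerTorus Lc M n)) × Fin (d + 1)) ℝ
  | M, _, _, rs, 0 => combF Lc M (rs 0)
  | M, _, lev, rs, n + 1 =>
    Matrix.fromRows (combF Lc M (rs 0) * compRowsG Lc Q M lev rs (n + 1))
      (nestedSliceG (fine Lc M) (fun k => lev (k + 1)) (fun k => rs (k + 1)) n)

/-- unfolding, depth `0`. -/
@[simp] theorem nestedSliceG_zero (M : Fin (d + 1) → ℕ) [∀ μ, NeZero (M μ)] (lev : ℕ → ℕ) (rs : ℕ → (Fin (d + 1) → ℕ)) :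
    nestedSliceG Lc Q M lev rs 0 = combF Lc M (rs 0) := rfl

/-- unfolding, depth `n+1` — BY `rfl`. -/
theorem nestedSliceG_succ (M : Fin (d + 1) → ℕ) [∀ μ, NeZero (M μ)] (lev : ℕ → ℕ) (rs : ℕ → (Fin (d + 1) → ℕ)) (n : ℕ) :
    nestedSliceG Lc Q M lev rs (n + 1)
      = Matrix.fromRows (combF Lc M (rs 0) * compRowsG Lc Q M lev rs (n + 1))
          (nestedSliceG Lc Q (fine Lc M) (fun k => lev (k + 1)) (fun k => rs (k + 1)) n) := rfl

/-- the one-fold generic nested slice: `fromRows (τ₂ * Q M (lev 1) (rs 1)) τ₁`. -/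
theorem nestedSliceG_one (M : Fin (d + 1) → ℕ) [∀ μ, NeZero (M μ)] (lev : ℕ → ℕ) (rs : ℕ → (Fin (d + 1) → ℕ)) :
    nestedSliceG Lc Q M lev rs 1 = Matrix.fromRows (combF Lc M (rs 0) * Q M (lev 1) (rs 1)) (combF Lc (fine Lc M) (rs 1)) := by
  rw [nestedSliceG_succ, compRowsG_one]; rfl

end Generic

/-! ## §2 The rooted tower of record IS the generic tower at `Q := Qstep Lc` -/

section Rooted

variable (Lc : ℕ) [NeZero Lc]

/-- **`compRows = compRowsG (Qstep)`** at every depth (structural induction; `rfl` at depth `0`, the two `_succ` unfoldings at depth `n+1`). -/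
theorem compRows_eq_compRowsG : ∀ (M : Fin (d + 1) → ℕ) [∀ μ, NeZero (M μ)] (lev : ℕ → ℕ) (rs : ℕ → (Fin (d + 1) → ℕ)) (n : ℕ),
    compRows Lc M lev rs n = compRowsG Lc (fun M _ ℓ r => Qstep Lc M ℓ r) M lev rs n
  | M, _, lev, rs, 0 => rfl
  | M, _, lev, rs, n + 1 => by
      rw [compRows_succ, compRowsG_succ, compRows_eq_compRowsG (fine Lc M) (fun k => lev (k + 1)) (fun k => rs (k + 1)) n]

/-- **`nestedSlice = nestedSliceG (Qstep)`** at every depth. -/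
theorem nestedSlice_eq_nestedSliceG : ∀ (M : Fin (d + 1) → ℕ) [∀ μ, NeZero (M μ)] (lev : ℕ → ℕ) (rs : ℕ → (Fin (d + 1) → ℕ)) (n : ℕ),
    nestedSlice Lc M lev rs n = nestedSliceG Lc (fun M _ ℓ r => Qstep Lc M ℓ r) M lev rs n
  | M, _, lev, rs, 0 => rfl
  | M, _, lev, rs, n + 1 => by
      rw [nestedSlice_succ, nestedSliceG_succ, compRows_eq_compRowsG,
        nestedSlice_eq_nestedSliceG (fine Lc M) (fun k => lev (k + 1)) (fun k => rs (k + 1)) n]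

end Rooted

/-! ## §3 The (0.4)-symmetrised instance: `QstepSym`, `compRowsSym`, `nestedSliceSym` -/

section Sym

variable (Lc : ℕ) [NeZero Lc]

/-- [our object — bookkeeping] **THE (0.4)-SYMMETRISED ONE-STEP ROWS BETWEEN `M` AND `fine Lc M`** at level `ℓ`: `Qstep`'s shape with the rooted step
kernel `bhKStepAt d (toSite r) Lc ℓ` replaced by an1's shifted straight spread `𝕄_ℓ = bhKStepSh d Lc (Dsh Lc) ℓ` (root-free; combs at the centred root) —
the `hQ₁₀` binder of the (III′) torus call `NestedStepLawTorusTransportedRowsGradedSym` character for character. -/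
def QstepSym (M : Fin (d + 1) → ℕ) [∀ μ, NeZero (M μ)] (ℓ : ℕ) :
    Matrix (↥(pbox M) × Fin (d + 1)) (↥(pbox (fine Lc M)) × Fin (d + 1)) ℝ :=
  (perF (fine Lc M) (bhKStepSh d Lc (Dsh Lc) ℓ)).submatrix
    (fun a : ↥(pbox M) × Fin (d + 1) => ((coarsePt M Lc a.1, Sum.inr a.2) : Idx (fine Lc M) (Fib d)))
    (fun b : ↥(pbox (fine Lc M)) × Fin (d + 1) => ((b.1, Sum.inl b.2) : Idx (fine Lc M) (Fib d)))

/-- [our object — bookkeeping] the (0.4)-symmetrised rows AS A STEP-ROW FAMILY (the root slot ignored: the kernel is root-free) — REDUCIBLE, so that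
every generic (`…G`) theorem over `Q : StepRows d Lc` applies to the `Sym` spellings below by `exact` ∕ token substitution `Q ↦ QSym Lc`. -/
abbrev QSym : StepRows d Lc := fun M _ ℓ _ => QstepSym Lc M ℓ

/-- [our object — bookkeeping] **THE (0.4)-SYMMETRISED `n`-FOLD COMPOSITE AVERAGING** = the generic tower at the root-free family `QSym Lc` (REDUCIBLE
abbreviation; the comb-root list `rs` is kept as a parameter, signature-uniform with `compRows`; the record takes `rs k := ctrOff (d+1) Lc`). -/
abbrev compRowsSym (M : Fin (d + 1) → ℕ) [∀ μ, NeZero (M μ)] (lev : ℕ → ℕ) (rs : ℕ → (Fin (d + 1) → ℕ)) (n : ℕ) :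
    Matrix (↥(pbox M) × Fin (d + 1)) (↥(pbox (towerTorus Lc M n)) × Fin (d + 1)) ℝ :=
  compRowsG Lc (QSym Lc) M lev rs n

/-- [our object — bookkeeping] **THE (0.4)-SYMMETRISED NESTED COMB SLICE** = the generic nested slice at `QSym Lc` (REDUCIBLE abbreviation). -/
abbrev nestedSliceSym (M : Fin (d + 1) → ℕ) [∀ μ, NeZero (M μ)] (lev : ℕ → ℕ) (rs : ℕ → (Fin (d + 1) → ℕ)) (n : ℕ) :
    Matrix (NParam Lc M rs n) (↥(pbox (towerTorus Lc M n)) × Fin (d + 1)) ℝ :=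
  nestedSliceG Lc (QSym Lc) M lev rs n

/-- unfolding, depth `0`. -/
theorem compRowsSym_zero (M : Fin (d + 1) → ℕ) [∀ μ, NeZero (M μ)] (lev : ℕ → ℕ) (rs : ℕ → (Fin (d + 1) → ℕ)) :
    compRowsSym Lc M lev rs 0 = (1 : Matrix (↥(pbox M) × Fin (d + 1)) (↥(pbox M) × Fin (d + 1)) ℝ) := rfl

/-- unfolding, depth `n+1` — TOP-PEEL BY `rfl` (the sym twin of `compRows_succ`). -/
theorem compRowsSym_succ (M : Fin (d + 1) → ℕ) [∀ μ, NeZero (M μ)] (lev : ℕ → ℕ) (rs : ℕ → (Fin (d + 1) → ℕ)) (n : ℕ) :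
    compRowsSym Lc M lev rs (n + 1) = QstepSym Lc M (lev 1) * compRowsSym Lc (fine Lc M) (fun k => lev (k + 1)) (fun k => rs (k + 1)) n := rfl

/-- the one-fold sym composite is the sym one-step rows (the sym twin of `compRows_one` ∕ (III′)'s `hQ₁₀`). -/
theorem compRowsSym_one (M : Fin (d + 1) → ℕ) [∀ μ, NeZero (M μ)] (lev : ℕ → ℕ) (rs : ℕ → (Fin (d + 1) → ℕ)) :
    compRowsSym Lc M lev rs 1 = QstepSym Lc M (lev 1) :=
  Matrix.mul_one _

/-- unfolding, depth `0`. -/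
theorem nestedSliceSym_zero (M : Fin (d + 1) → ℕ) [∀ μ, NeZero (M μ)] (lev : ℕ → ℕ) (rs : ℕ → (Fin (d + 1) → ℕ)) :
    nestedSliceSym Lc M lev rs 0 = combF Lc M (rs 0) := rfl

/-- unfolding, depth `n+1` — BY `rfl` (the sym twin of `nestedSlice_succ`, leaf-05 g28's interface shape). -/
theorem nestedSliceSym_succ (M : Fin (d + 1) → ℕ) [∀ μ, NeZero (M μ)] (lev : ℕ → ℕ) (rs : ℕ → (Fin (d + 1) → ℕ)) (n : ℕ) :
    nestedSliceSym Lc M lev rs (n + 1)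
      = Matrix.fromRows (combF Lc M (rs 0) * compRowsSym Lc M lev rs (n + 1))
          (nestedSliceSym Lc (fine Lc M) (fun k => lev (k + 1)) (fun k => rs (k + 1)) n) := rfl

/-- the one-fold sym nested slice is `fromRows (τ₂ * QstepSym M (lev 1)) τ₁` (the sym twin of `nestedSlice_one`). -/
theorem nestedSliceSym_one (M : Fin (d + 1) → ℕ) [∀ μ, NeZero (M μ)] (lev : ℕ → ℕ) (rs : ℕ → (Fin (d + 1) → ℕ)) :
    nestedSliceSym Lc M lev rs 1 = Matrix.fromRows (combF Lc M (rs 0) * QstepSym Lc M (lev 1)) (combF Lc (fine Lc M) (rs 1)) := by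
  rw [nestedSliceSym_succ, compRowsSym_one]; rfl

end Sym

end Summit.QuantumFields.BalabanUV.Beta.FP.TorusCompositeObjectsG

end
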